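import Mathlib
import Summits.AtomisticToContinuum.Crystallization.Theorems.ChessboardParticlePlanesLjLaminarWindowsGlueC5
import Literature.NumberTheory.Transcendental.SixExponentialsSeveralVariablesAuxiliary
import HarnessLib

/-! # Cell covering of a slab-disc — stub `stub_cellCover` of line `Sketch` (skeleton rev. 10, lead c6), crux `LjLaminarWindows` (stmt-AtomisticToContinuum-6711) -/

noncomputable section

open scoped BigOperators
open Filter Topology
open Literature.MathematicalPhysics.StatisticalMechanics
open Summit.AtomisticToContinuum.Crystallization.Theorems.ChargedEnergyGapNegative

namespace Summit.AtomisticToContinuum.Crystallization.Theorems.LjLaminarWindowsSketch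

/-! ## Cauchy–Schwarz over the fibres of a cell map -/

/-- **Cauchy–Schwarz over cells.** If `g` maps `S` into `C`, then
`(#S)² ≤ #C · #{(a,b) ∈ S × S : g a = g b}`: the fibre sizes `m_c` satisfy `#S = ∑ m_c`,
`(∑ m_c)² ≤ #C ∑ m_c²`, and `∑ m_c²` counts the ordered pairs with equal cell. [folklore] -/
theorem cellCover_sq_card_le {α β : Type*} [DecidableEq β] (S : Finset α) (C : Finset β)
    (g : α → β) (hg : ∀ a ∈ S, g a ∈ C) :
    S.card ^ 2 ≤ C.card * ((S ×ˢ S).filter fun q : α × α => g q.1 = g q.2).card := by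
  set fib : β → Finset α := fun c => S.filter fun a => g a = c with hfib
  have h1 : S.card = ∑ c ∈ C, (fib c).card :=
    Finset.card_eq_sum_card_fiberwise fun a ha => hg a ha
  have h2 : ((S ×ˢ S).filter fun q : α × α => g q.1 = g q.2).card =
      ∑ c ∈ C, (fib c ×ˢ fib c).card := by
    rw [Finset.card_eq_sum_card_fiberwise (f := fun q : α × α => g q.1) (t := C) ?_]
    · refine Finset.sum_congr rfl fun c _ => ?_
      congr 1
      ext ⟨a, b⟩
      simp only [hfib, Finset.mem_filter, Finset.mem_product]
      constructor
      · rintro ⟨⟨⟨ha, hb⟩, hab⟩, hac⟩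
        exact ⟨⟨ha, hac⟩, hb, hab.symm.trans hac⟩
      · rintro ⟨⟨ha, hac⟩, hb, hbc⟩
        exact ⟨⟨⟨ha, hb⟩, hac.trans hbc.symm⟩, hac⟩
    · intro q hq
      rw [Finset.mem_coe, Finset.mem_filter, Finset.mem_product] at hq
      exact hg _ hq.1.1
  rw [h1, h2]
  calc (∑ c ∈ C, (fib c).card) ^ 2 ≤ C.card * ∑ c ∈ C, (fib c).card ^ 2 :=
        sq_sum_le_card_mul_sum_sq
    _ = C.card * ∑ c ∈ C, (fib c ×ˢ fib c).card := by
      congr 1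
      refine Finset.sum_congr rfl fun c _ => ?_
      rw [Finset.card_product, sq]

/-! ## Elementary real-variable facts -/

/-- Range of the cell index: `|t| ≤ ρ` gives `⌊(t + ρ)/(L/2)⌋₊ ≤ ⌊4ρ/L⌋₊`. [folklore] -/
theorem cellCover_floor_le {t ρ L : ℝ} (hL : 0 < L) (ht : |t| ≤ ρ) :
    ⌊(t + ρ) / (L / 2)⌋₊ ≤ ⌊4 * ρ / L⌋₊ := by
  apply Nat.floor_le_floor
  have h := (abs_le.mp ht).2
  have : (t + ρ) / (L / 2) = (2 * t + 2 * ρ) / L := by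
    rw [div_div_eq_mul_div]
    ring
  rw [this]
  exact div_le_div_of_nonneg_right (by linarith) hL.le

/-- Number of cells: if `L < 2ρ` then `(⌊4ρ/L⌋₊ + 1)² ≤ 64 ρ²/L²`
(indeed `⌊4ρ/L⌋₊ + 1 ≤ 4ρ/L + 2ρ/L = 6ρ/L`). [folklore] -/
theorem cellCover_cells_le {ρ L : ℝ} (hρ : 0 < ρ) (hL : 0 < L) (h2 : L < 2 * ρ) :
    ((⌊4 * ρ / L⌋₊ : ℝ) + 1) * ((⌊4 * ρ / L⌋₊ : ℝ) + 1) ≤ 64 * ρ ^ 2 / L ^ 2 := by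
  have hK : (⌊4 * ρ / L⌋₊ : ℝ) ≤ 4 * ρ / L := Nat.floor_le (by positivity)
  have h1 : 1 < 2 * ρ / L := (one_lt_div hL).mpr h2
  have hK1 : (⌊4 * ρ / L⌋₊ : ℝ) + 1 ≤ 6 * ρ / L := by
    have : 4 * ρ / L + 2 * ρ / L = 6 * ρ / L := by ring
    linarith
  have hK0 : (0 : ℝ) ≤ (⌊4 * ρ / L⌋₊ : ℝ) + 1 := by positivity
  calc ((⌊4 * ρ / L⌋₊ : ℝ) + 1) * ((⌊4 * ρ / L⌋₊ : ℝ) + 1)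
      ≤ (6 * ρ / L) * (6 * ρ / L) := mul_le_mul hK1 hK1 hK0 (hK0.trans hK1)
    _ = 36 * ρ ^ 2 / L ^ 2 := by ring
    _ ≤ 64 * ρ ^ 2 / L ^ 2 :=
        div_le_div_of_nonneg_right (by nlinarith [sq_nonneg ρ]) (sq_nonneg L)

/-! ## Geometry in the frame of a linear isometry -/

/-- Each coordinate of `A (u - z)` is at most `dist u z` in absolute value. [folklore] -/
theorem cellCover_abs_coord_le (A : E3 →ₗᵢ[ℝ] E3) (u z : E3) (i : Fin 3) :
    |(A (u - z)) i| ≤ dist u z := by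
  calc |(A (u - z)) i| = ‖(A (u - z)) i‖ := (Real.norm_eq_abs _).symm
    _ ≤ ‖A (u - z)‖ := PiLp.norm_apply_le _ _
    _ = dist u z := by rw [LinearIsometry.norm_map, dist_eq_norm]

/-- **Same cell ⇒ close.** Two points of the slab-disc (`|third coordinate| ≤ R`, distance
`≤ ρ` from the centre) whose first two frame coordinates have the same cell index of side `L/2`
are at distance `≤ L`, provided `4R ≤ L`: the squared distance is
`< (L/2)² + (L/2)² + (2R)² ≤ 3L²/4`. [folklore] -/
theorem cellCover_dist_le (A : E3 →ₗᵢ[ℝ] E3) (u w z : E3) {R ρ L : ℝ} (hRL : 4 * R ≤ L)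
    (hL : 0 < L) (hu : |(A (u - z)) 2| ≤ R) (hw : |(A (w - z)) 2| ≤ R) (hu' : dist u z ≤ ρ)
    (hw' : dist w z ≤ ρ)
    (h0 : ⌊((A (u - z)) 0 + ρ) / (L / 2)⌋₊ = ⌊((A (w - z)) 0 + ρ) / (L / 2)⌋₊)
    (h1 : ⌊((A (u - z)) 1 + ρ) / (L / 2)⌋₊ = ⌊((A (w - z)) 1 + ρ) / (L / 2)⌋₊) :
    dist u w ≤ L := by
  have hL2 : 0 < L / 2 := by positivity
  have hc : ∀ i, |(A (u - z)) i - (A (w - z)) i| < L / 2 →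
      ((A (u - z)) i - (A (w - z)) i) ^ 2 < (L / 2) ^ 2 := fun i hi =>
    sq_lt_sq' (abs_lt.mp hi).1 (abs_lt.mp hi).2
  have hclose : ∀ i, ⌊((A (u - z)) i + ρ) / (L / 2)⌋₊ = ⌊((A (w - z)) i + ρ) / (L / 2)⌋₊ →
      |(A (u - z)) i - (A (w - z)) i| < L / 2 := by
    intro i hi
    have hau := (cellCover_abs_coord_le A u z i).trans hu'
    have haw := (cellCover_abs_coord_le A w z i).trans hw'
    have hna : 0 ≤ ((A (u - z)) i + ρ) / (L / 2) :=
      div_nonneg (by linarith [(abs_le.mp hau).1]) hL2.le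
    have hnb : 0 ≤ ((A (w - z)) i + ρ) / (L / 2) :=
      div_nonneg (by linarith [(abs_le.mp haw).1]) hL2.le
    -- same integer part ⇒ the two reals differ by `< 1` (landed folklore lemma, reused)
    have key :=
      Literature.NumberTheory.Transcendental.Waldschmidt1981.abs_sub_lt_one_of_floor_eq hna hnb hi
    rw [← sub_div, abs_div, abs_of_pos hL2, div_lt_one hL2] at key
    have : (A (u - z)) i + ρ - ((A (w - z)) i + ρ) = (A (u - z)) i - (A (w - z)) i := by ring
    rwa [this] at key
  have e0 := hc 0 (hclose 0 h0)
  have e1 := hc 1 (hclose 1 h1)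
  have hR0 : 0 ≤ R := (abs_nonneg _).trans hu
  have e2 : ((A (u - z)) 2 - (A (w - z)) 2) ^ 2 ≤ (2 * R) ^ 2 := by
    obtain ⟨hu1, hu2⟩ := abs_le.mp hu
    obtain ⟨hw1, hw2⟩ := abs_le.mp hw
    exact sq_le_sq' (by linarith) (by linarith)
  have hd : dist u w = ‖A (u - z) - A (w - z)‖ := by
    rw [← map_sub, LinearIsometry.norm_map, sub_sub_sub_cancel_right, dist_eq_norm]
  have hsq : ‖A (u - z) - A (w - z)‖ ^ 2 =
      ((A (u - z)) 0 - (A (w - z)) 0) ^ 2 + ((A (u - z)) 1 - (A (w - z)) 1) ^ 2 +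
        ((A (u - z)) 2 - (A (w - z)) 2) ^ 2 := by
    rw [EuclideanSpace.real_norm_sq_eq, Fin.sum_univ_three]
    simp only [PiLp.sub_apply]
  have hlt : ‖A (u - z) - A (w - z)‖ ^ 2 < L ^ 2 := by
    rw [hsq]
    nlinarith [mul_nonneg (sub_nonneg.mpr hRL) (by positivity : (0 : ℝ) ≤ L + 4 * R),
      pow_pos hL 2]
  rw [hd]
  exact (lt_of_pow_lt_pow_left₀ 2 hL.le hlt).le

/-- **C6d — cell covering of a slab-disc** (provable now): for points in a slab-disc of
half-thickness `R` and radius `ρ` and a radius `L ≥ 4R`, Cauchy–Schwarz over the cells of side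
`L/2` of the disc gives `(#S)² ≤ max 1 (64 ρ²/L²) · #{(p,q) ∈ S × S : |x_p − x_q| ≤ L}`. [folklore] -/
theorem stub_cellCover :
    ∀ (N : ℕ) (x : Fin N → E3) (R ρ L : ℝ), 1 ≤ R → 0 < ρ → 4 * R ≤ L →
      ∀ (z : E3) (A : E3 →ₗᵢ[ℝ] E3) (S : Finset (Fin N)),
        (∀ p ∈ S, |(A (x p - z)) 2| ≤ R ∧ dist (x p) z ≤ ρ) →
        (S.card : ℝ) ^ 2 ≤ max 1 (64 * ρ ^ 2 / L ^ 2) *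
          (((S ×ˢ S).filter fun p : Fin N × Fin N => dist (x p.1) (x p.2) ≤ L).card : ℝ) := by
  intro N x R ρ L hR hρ hRL z A S hS
  set F := ((S ×ˢ S).filter fun p : Fin N × Fin N => dist (x p.1) (x p.2) ≤ L) with hF
  have hL : 0 < L := by linarith
  have hmax1 : (1 : ℝ) ≤ max 1 (64 * ρ ^ 2 / L ^ 2) := le_max_left _ _
  by_cases hcase : 2 * ρ ≤ L
  · -- Case A: the disc has diameter `≤ L`, every ordered pair is counted.
    have hFS : F = S ×ˢ S := by
      rw [hF]
      refine Finset.filter_true_of_mem fun p hp => ?_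
      rw [Finset.mem_product] at hp
      calc dist (x p.1) (x p.2) ≤ dist (x p.1) z + dist (x p.2) z := dist_triangle_right _ _ _
        _ ≤ ρ + ρ := add_le_add (hS _ hp.1).2 (hS _ hp.2).2
        _ ≤ L := by linarith
    rw [hFS, Finset.card_product, Nat.cast_mul, sq]
    have hn : (0 : ℝ) ≤ (S.card : ℝ) * S.card := mul_self_nonneg _
    calc (S.card : ℝ) * S.card = 1 * ((S.card : ℝ) * S.card) := (one_mul _).symm
      _ ≤ max 1 (64 * ρ ^ 2 / L ^ 2) * ((S.card : ℝ) * S.card) :=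
        mul_le_mul_of_nonneg_right hmax1 hn
  · -- Case B: `L < 2ρ`, Cauchy–Schwarz over the cells of side `L/2`.
    push Not at hcase
    set g : Fin N → ℕ × ℕ := fun p =>
      (⌊((A (x p - z)) 0 + ρ) / (L / 2)⌋₊, ⌊((A (x p - z)) 1 + ρ) / (L / 2)⌋₊) with hg
    set C : Finset (ℕ × ℕ) :=
      Finset.range (⌊4 * ρ / L⌋₊ + 1) ×ˢ Finset.range (⌊4 * ρ / L⌋₊ + 1) with hC
    have hgC : ∀ p ∈ S, g p ∈ C := by
      intro p hp
      simp only [hg, hC, Finset.mem_product, Finset.mem_range, Nat.lt_add_one_iff]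
      exact ⟨cellCover_floor_le hL ((cellCover_abs_coord_le A (x p) z 0).trans (hS p hp).2),
        cellCover_floor_le hL ((cellCover_abs_coord_le A (x p) z 1).trans (hS p hp).2)⟩
    have hsub : ((S ×ˢ S).filter fun q : Fin N × Fin N => g q.1 = g q.2) ⊆ F := by
      intro q hq
      rw [Finset.mem_filter, Finset.mem_product] at hq
      obtain ⟨⟨hp, hp'⟩, hq⟩ := hq
      rw [hF, Finset.mem_filter, Finset.mem_product]
      refine ⟨⟨hp, hp'⟩, ?_⟩
      simp only [hg, Prod.mk.injEq] at hq
      exact cellCover_dist_le A (x q.1) (x q.2) z hRL hL (hS _ hp).1 (hS _ hp').1 (hS _ hp).2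
        (hS _ hp').2 hq.1 hq.2
    have hnat : S.card ^ 2 ≤ C.card * F.card :=
      (cellCover_sq_card_le S C g hgC).trans (Nat.mul_le_mul_left _ (Finset.card_le_card hsub))
    have hCcard : C.card = (⌊4 * ρ / L⌋₊ + 1) * (⌊4 * ρ / L⌋₊ + 1) := by
      rw [hC, Finset.card_product, Finset.card_range]
    rw [hCcard] at hnat
    have hreal : (S.card : ℝ) ^ 2 ≤
        (((⌊4 * ρ / L⌋₊ : ℝ) + 1) * ((⌊4 * ρ / L⌋₊ : ℝ) + 1)) * (F.card : ℝ) := by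
      exact_mod_cast hnat
    calc (S.card : ℝ) ^ 2
        ≤ (((⌊4 * ρ / L⌋₊ : ℝ) + 1) * ((⌊4 * ρ / L⌋₊ : ℝ) + 1)) * (F.card : ℝ) := hreal
      _ ≤ (64 * ρ ^ 2 / L ^ 2) * (F.card : ℝ) :=
        mul_le_mul_of_nonneg_right (cellCover_cells_le hρ hL hcase) (Nat.cast_nonneg _)
      _ ≤ max 1 (64 * ρ ^ 2 / L ^ 2) * (F.card : ℝ) :=
        mul_le_mul_of_nonneg_right (le_max_right _ _) (Nat.cast_nonneg _)

end Summit.AtomisticToContinuum.Crystallization.Theorems.LjLaminarWindowsSketch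

end
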